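import Literature.Probability.Percolation.ArmSeparationInLandingFour
import Literature.Probability.Percolation.ArmSeparationInwardExt
import Literature.Probability.Percolation.ArmSeparationOutExtFour
import HarnessLib

/-!
# Inward extension of four landed arms of alternating colours, at constant cost, at `p`

Topic `Literature/Probability/Percolation`; family `crit-perc` / near-critical percolation on `𝕋`.
A brick of the near-critical arm-separation theorem for four arms of alternating colours
(P. Nolin, *Near-critical percolation in two dimensions*, EJP 13 (2008), Thm. 11 for `j = 4`,
`σ = BWBW` [arXiv 0711.4948: Thm. 10]; §4.4 p. 12–13, the constant `C₀` read on the internal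
boundary; Prop. 12 (i)): the constant-cost extension step of the multi-scale scheme for the four
arms landed inside on the sides `0, 2, 3, 5` of `∂Λ_m` and outside at the frame offset `q`,
`sepFourArmG m N q` (`ArmSeparationInLandingFour`), at a general parameter `p` with
Russo–Seymour–Welsh inputs at `p` and `1 - p`:

  `P_p(sepFourArmG m N q) · (c^93)⁴ ≤ P_p(sepFourArmG m' N q)`  for `1100 ≤ m'`, `2m'+1 ≤ m ≤ 3m'`, `2m ≤ N`.

The inward corridor of `ArmSeparationInwardExt` (comb boxes over the inner free spaces, a highway,
a horizontal box, the target free space at `(m', -m'/2)`) is bent so as to stay in the open sector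
`{x₁ < 0 < x₀ + x₁}` of the side `0` (`sepInCorrQ`: the highway is moved to the columns
`[m - m/8 - m/16 - 2, m - m/8 - 2]` and stops at the row `-m'/2 + m/32`); the sectors of the four
sides are pairwise disjoint, and the landed-arm events only depend, inside `Λ̊_m`, on sites of their
sectors (`armConeSet`, `determinedBy_sepArmGen_cone`). Then:

* `sepArmGen_inter_sepInCorrQ_subset` — deterministic gluing (relay lemma);
* `le_real_sepInCorrQ_at` — `P_q(sepInCorrQ m m') ≥ c^93` from RSW at `q` (aspect ratio `256`);
* `real_sepFourArmG_mul_le_inward_at` — the extension inequality, by Nolin's Lemma 13 for locally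
  monotone events (`triSitePercolation_locallyMonotone_fkg`) with the shared shell
  `{m ≤ |v| ≤ N + N/8}`, the increasing region (sectors of the sides `0`, `3` inside `Λ̊_m`) and the
  decreasing region (sectors of the sides `2`, `5`), Harris at `p` and at `1 - p`.

Everything here is proved; no named facts are introduced.

## References

* P. Nolin, Near-critical percolation in two dimensions, *Electron. J. Probab.* 13 (2008), §4.3
  Prop. 12 (i) and Lemma 13, §4.4 (arXiv 0711.4948: Prop. 11, Lemma 12; proof of Thm. 10, pp. 12–13) [Nolin2008].
* H. Kesten, Scaling relations for 2D-percolation, *Comm. Math. Phys.* 109 (1987), Lemma 2 [Kesten1987].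
-/

noncomputable section

open MeasureTheory Set

namespace Literature.Probability.Percolation

open LatticeModels

/-! ### Monotonicity and the sector support of a landed arm -/

/-- Framing an intersection. [folklore] -/
theorem frameConfig_inter' (i : ℕ) (ω T : Set (Site 2)) : frameConfig i (ω ∩ T) = frameConfig i ω ∩ frameConfig i T := by
  ext v; simp only [mem_frameConfig, Set.mem_inter_iff]

/-- `sepArmGen` is increasing. [folklore] -/
theorem isUpperSet_sepArmGen (n N q : ℕ) : IsUpperSet (sepArmGen n N q) := by
  rintro ω ω' hle ⟨z, zo, u, uo, hz, hzo, ⟨b, t, hb, ht, p₁, p₂⟩, ⟨b', t', hb', ht', p₃, p₄⟩, p₅⟩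
  have hle' : frameConfig q ω ≤ frameConfig q ω' := frameConfig_mono q hle
  exact ⟨z, zo, u, uo, hz, hzo,
    ⟨b, t, hb, ht, p₁.mono fun v hv => ⟨hv.1, hle hv.2⟩, p₂.mono fun v hv => ⟨hv.1, hle hv.2⟩⟩,
    ⟨b', t', hb', ht', p₃.mono fun v hv => ⟨hv.1, hle' hv.2⟩, p₄.mono fun v hv => ⟨hv.1, hle' hv.2⟩⟩,
    p₅.mono fun v hv => ⟨hv.1, hle hv.2⟩⟩

/-- **The sector support of the landed arm event `sepArmGen m N q`**: the shell
`{m - m/8 ≤ |v| ≤ N + N/8}`, the sites inside `Λ̊_m` lying in the open sector `{x₁ < 0 < x₀ + x₁}` of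
the right side. [cite: Nolin2008, §4.2 Def. 6–7 (arXiv 0711.4948)] -/
def armConeSet (m N : ℕ) : Set (Site 2) :=
  {v | (m : ℤ) - (m / 8 : ℕ) ≤ triNorm v ∧ triNorm v ≤ (N : ℤ) + (N / 8 : ℕ) ∧ (triNorm v < (m : ℤ) → v 1 < 0 ∧ 0 < v 0 + v 1)}

/-- Membership in `armConeSet`, unfolded. [folklore] -/
@[simp] theorem mem_armConeSet {m N : ℕ} {v : Site 2} :
    v ∈ armConeSet m N ↔ (m : ℤ) - (m / 8 : ℕ) ≤ triNorm v ∧ triNorm v ≤ (N : ℤ) + (N / 8 : ℕ) ∧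
      (triNorm v < (m : ℤ) → v 1 < 0 ∧ 0 < v 0 + v 1) := Iff.rfl

section Cone

variable {m N q : ℕ}

/-- The inner free space lies in the sector support (`z ∈ sepLanding m`, `64 ≤ m`, `m ≤ N`). [folklore] -/
theorem sepInnerFence_subset_armConeSet (hm : 64 ≤ m) (hmN : m ≤ N) {z : Site 2} (hz : z ∈ sepLanding m) :
    sepInnerFence m z ⊆ armConeSet m N := by
  intro v hv
  rw [mem_sepLanding] at hz
  rw [mem_sepInnerFence] at hv
  have hmN' : (m : ℤ) ≤ N := by exact_mod_cast hmN
  have hvn : triNorm v ≤ (m : ℤ) := triNorm_le_iff_lin.2 (by omega)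
  refine ⟨le_triNorm_iff_lin.2 (Or.inl (by omega)), hvn.trans (by omega), fun _ => ⟨by omega, by omega⟩⟩

/-- The arm region lies in the sector support (`z ∈ sepLanding m`, `zo ∈ sepLanding N`, `q < 6`,
`64 ≤ m`, `2m ≤ N`). [folklore] -/
theorem genRegion_subset_armConeSet (hq : q < 6) (hm : 64 ≤ m) (hmN : 2 * m ≤ N) {z zo : Site 2} (hz : z ∈ sepLanding m)
    (hzo : zo ∈ sepLanding N) :
    triAnnulusSet m N ∪ frameIso q '' triOpenBall zo (N / 8) ∪ triOpenBall z (m / 8) ⊆ armConeSet m N := by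
  rw [mem_sepLanding] at hz hzo
  have hmN' : 2 * (m : ℤ) ≤ N := by exact_mod_cast hmN
  rintro v ((hv | ⟨w, hw, rfl⟩) | hv)
  · rw [mem_triAnnulusSet] at hv
    exact ⟨by omega, by omega, fun h => absurd hv.1 (not_le.2 h)⟩
  · rw [mem_armConeSet, show ((frameIso q : triGraph ≃g triGraph) w) = frameIso q w from rfl, triNorm_frameIso q hq]
    rw [mem_triOpenBall, triNorm_lt_iff_lin] at hw
    simp only [Pi.sub_apply] at hw
    have h1 : (N : ℤ) - (N / 8 : ℕ) ≤ triNorm w := le_triNorm_iff_lin.2 (Or.inl (by omega))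
    have h2 : triNorm w ≤ (N : ℤ) + (N / 8 : ℕ) := triNorm_le_iff_lin.2 (by omega)
    exact ⟨by omega, h2, fun h => by omega⟩
  · rw [mem_triOpenBall, triNorm_lt_iff_lin] at hv
    simp only [Pi.sub_apply] at hv
    have hvn : triNorm v ≤ (m : ℤ) + (m / 8 : ℕ) := triNorm_le_iff_lin.2 (by omega)
    exact ⟨le_triNorm_iff_lin.2 (Or.inl (by omega)), hvn.trans (by omega), fun _ => ⟨by omega, by omega⟩⟩

/-- The outer free space, framed, lies in the sector support (`zo ∈ sepLanding N`, `q < 6`, `m ≤ N`). [folklore] -/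
theorem sepOuterFence_subset_frameConfig_armConeSet (hq : q < 6) (hmN : m ≤ N) {zo : Site 2} (hzo : zo ∈ sepLanding N) :
    sepOuterFence N zo ⊆ frameConfig q (armConeSet m N) := by
  intro v hv
  rw [mem_sepLanding] at hzo
  rw [mem_sepOuterFence] at hv
  rw [mem_frameConfig, mem_armConeSet, triNorm_frameIso q hq]
  have hmN' : (m : ℤ) ≤ N := by exact_mod_cast hmN
  have h1 : (N : ℤ) + 1 ≤ triNorm v := le_triNorm_iff_lin.2 (Or.inl hv.1)
  refine ⟨by omega, triNorm_le_iff_lin.2 (by omega), fun h => absurd h1 (by omega)⟩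

/-- The event only depends on the sites of its sector support (`q < 6`, `64 ≤ m`, `2m ≤ N`). [folklore] -/
theorem mem_sepArmGen_iff_inter_cone (hq : q < 6) (hm : 64 ≤ m) (hmN : 2 * m ≤ N) (ω : SiteConfig (Site 2)) :
    ω ∈ sepArmGen m N q ↔ ω ∩ armConeSet m N ∈ sepArmGen m N q := by
  constructor
  · rintro ⟨z, zo, u, uo, hz, hzo, ⟨b, t, hb, ht, p₁, p₂⟩, ⟨b', t', hb', ht', p₃, p₄⟩, p⟩
    have hI := sepInnerFence_subset_armConeSet (N := N) hm (by omega) hz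
    have hO := sepOuterFence_subset_frameConfig_armConeSet (m := m) hq (by omega) hzo
    have hR := genRegion_subset_armConeSet hq hm hmN hz hzo
    refine ⟨z, zo, u, uo, hz, hzo, ⟨b, t, hb, ht, (pathIn_inter_inter_of_subset hI).2 p₁, (pathIn_inter_inter_of_subset hI).2 p₂⟩,
      ⟨b', t', hb', ht', ?_, ?_⟩, (pathIn_inter_inter_of_subset hR).2 p⟩
    · rw [frameConfig_inter']; exact (pathIn_inter_inter_of_subset hO).2 p₃
    · rw [frameConfig_inter']; exact (pathIn_inter_inter_of_subset hO).2 p₄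
  · intro h
    exact isUpperSet_sepArmGen m N q (show ω ∩ armConeSet m N ≤ ω from inter_subset_left) h

/-- **Locality of the landed arm in its sector**: `sepArmGen m N q` is determined by
`armConeSet m N` (`q < 6`, `64 ≤ m`, `2m ≤ N`). [folklore] -/
theorem determinedBy_sepArmGen_cone (hq : q < 6) (hm : 64 ≤ m) (hmN : 2 * m ≤ N) :
    DeterminedBy (sepArmGen m N q) (armConeSet m N) := by
  rw [determinedBy_iff]
  intro ω ω' hω
  rw [mem_sepArmGen_iff_inter_cone hq hm hmN ω, mem_sepArmGen_iff_inter_cone hq hm hmN ω', hω]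

end Cone

/-! ### The bent inward corridor -/

/-- The `i`-th comb box `[m - m/8 - m/16 - 2, m - 1] × [g_i, g_i + h]`, `g_i = -(m - m/4 + m/64) + i h`,
`h = (m/64)/2`, crossed horizontally. [cite: Nolin2008, §4.3 Prop. 12 (proof) (arXiv 0711.4948: Prop. 11)] -/
def sepInCombQ (m i : ℕ) : Set (SiteConfig (Site 2)) :=
  triHCross ((m : ℤ) - (m / 8 : ℕ) - (m / 16 : ℕ) - 2) (-(sepGlueHeight m : ℤ) + i * ((m / 64 / 2 : ℕ) : ℤ)) (m / 8 + m / 16 + 1) (m / 64 / 2)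

/-- Membership in the strip of a comb box. [folklore] -/
theorem sepInCombQ_strip_iff {m i : ℕ} {v : Site 2} :
    v ∈ triStrip ((m : ℤ) - (m / 8 : ℕ) - (m / 16 : ℕ) - 2) (-(sepGlueHeight m : ℤ) + i * ((m / 64 / 2 : ℕ) : ℤ)) (m / 8 + m / 16 + 1) (m / 64 / 2) ↔
      (m : ℤ) - (m / 8 : ℕ) - (m / 16 : ℕ) - 2 ≤ v 0 ∧ v 0 ≤ (m : ℤ) - 1 ∧
        -(sepGlueHeight m : ℤ) + i * ((m / 64 / 2 : ℕ) : ℤ) ≤ v 1 ∧ v 1 ≤ -(sepGlueHeight m : ℤ) + i * ((m / 64 / 2 : ℕ) : ℤ) + (m / 64 / 2 : ℕ) := by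
  rw [mem_triStrip]; simp only [Nat.cast_add, Nat.cast_one]; omega

/-- **The bent inward corridor** from the inner free spaces at scale `m` (right side of `Λ_m`) to the
inner free space `sepInnerFence m' (m', -m'/2)` at scale `m'`, inside the sector of the right side:
(i) an open vertical crossing of the thinned target free space
`[m' - m'/8 + 1, m' - 1] × [-m'/2 - m'/64, -m'/2 + m'/64]`; (ii) an open horizontal crossing of
`[m' - m'/8 + 1, m - m/8 - 2] × [-m'/2, -m'/2 + m'/64]`; (iii) an open vertical crossing of the
highway `[m - m/8 - m/16 - 2, m - m/8 - 2] × [-(m - m/4 + m/64), -m'/2 + m/32]`; (iv) the `90` comb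
boxes crossed horizontally. [cite: Nolin2008, §4.3 Prop. 12 (proof) (arXiv 0711.4948: Prop. 11)] -/
def sepInCorrQ (m m' : ℕ) : Set (SiteConfig (Site 2)) :=
  triVCross ((m' : ℤ) - (m' / 8 : ℕ) + 1) (-((m' / 2 : ℕ) : ℤ) - (m' / 64 : ℕ)) (m' / 8 - 2) (2 * (m' / 64)) ∩
    triHCross ((m' : ℤ) - (m' / 8 : ℕ) + 1) (-((m' / 2 : ℕ) : ℤ)) (m - m / 8 - m' + m' / 8 - 3) (m' / 64) ∩
    triVCross ((m : ℤ) - (m / 8 : ℕ) - (m / 16 : ℕ) - 2) (-(sepGlueHeight m : ℤ)) (m / 16) (sepGlueHeight m - m' / 2 + m / 32) ∩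
    ⋂ i ∈ Finset.range 90, sepInCombQ m i

/-- `sepInCorrQ` is increasing. [folklore] -/
theorem isUpperSet_sepInCorrQ (m m' : ℕ) : IsUpperSet (sepInCorrQ m m') := by
  refine (((isUpperSet_triVCross _ _ _ _).inter (isUpperSet_triHCross _ _ _ _)).inter
    (isUpperSet_triVCross _ _ _ _)).inter ?_
  exact isUpperSet_iInter₂ fun i _ => isUpperSet_triHCross _ _ _ _

/-- Casting the height of the highway. [folklore] -/
theorem cast_highway_height {m m' : ℕ} (hm' : 64 ≤ m') (hmm' : 2 * m' + 1 ≤ m) :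
    ((sepGlueHeight m - m' / 2 + m / 32 : ℕ) : ℤ) = (sepGlueHeight m : ℤ) - (m' / 2 : ℕ) + (m / 32 : ℕ) := by
  have hH : sepGlueHeight m = m - m / 4 + m / 64 := rfl
  omega

/-! ### The deterministic gluing -/

/-- **Inward extension of a landed arm along the bent corridor** (Nolin 2008, Prop. 12 (i) on the
internal boundary; Kesten's fences): `sepArmGen m N q ∩ sepInCorrQ m m' ⊆ sepArmGen m' N q` for
`1100 ≤ m'`, `2m' + 1 ≤ m ≤ 3m'`, `2m ≤ N`, `q < 6` (the outer half of the arm is kept; the vertical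
crossing of the thinned target free space meets the horizontal box, which meets the highway, which
meets the comb box inside the old inner free space, which meets the old vertical crossing). [cite: Nolin2008, §4.3 Prop. 12 (i) (proof) (arXiv 0711.4948: Prop. 11); §4.4 p. 13] -/
theorem sepArmGen_inter_sepInCorrQ_subset {m m' N q : ℕ} (hm' : 1100 ≤ m') (hmm' : 2 * m' + 1 ≤ m) (hm3 : m ≤ 3 * m')
    (hN : 2 * m ≤ N) : sepArmGen m N q ∩ sepInCorrQ m m' ⊆ sepArmGen m' N q := by
  rintro ω ⟨⟨z, zo, u, uo, hz, hzo, ⟨b, t, hb, ht, Pa, Pb⟩, hOut, P5⟩, ⟨⟨⟨hV0, hH0⟩, hVh⟩, hG⟩⟩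
  have hzL := hz
  rw [mem_sepLanding] at hzL
  obtain ⟨hz'0, hz'1, hz'2⟩ := hzL
  -- the new landing site
  set z'' : Site 2 := ![(m' : ℤ), -((m' / 2 : ℕ) : ℤ)] with hz''
  have hz''1 : z'' 1 = -((m' / 2 : ℕ) : ℤ) := site_mk_apply_one _ _
  -- the corridor paths
  obtain ⟨b₀, t₀, hb₀, ht₀, PV⟩ := hV0
  obtain ⟨a₀, e₀, ha₀, he₀, PH⟩ := hH0
  obtain ⟨bh, th, hbh, hth, PVh⟩ := hVh
  obtain ⟨i, hi, hgi1, hgi2⟩ := exists_sepInComb_rows (by omega) hz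
  have hGi : ω ∈ sepInCombQ m i := (Set.mem_iInter₂.1 hG) i (Finset.mem_range.2 hi)
  obtain ⟨g₀, g₁, hg₀, hg₁, PG⟩ := hGi
  rw [cast_sepInCorr_width (by omega) hmm'] at he₀
  rw [cast_highway_height (by omega) hmm'] at hth
  have hH : (sepGlueHeight m : ℤ) = (m : ℤ) - (m / 4 : ℕ) + (m / 64 : ℕ) := by unfold sepGlueHeight; omega
  simp only [Nat.cast_add, Nat.cast_one] at ht₀ hg₁
  simp only [Nat.cast_mul, Nat.cast_ofNat] at ht₀
  have hih : (0 : ℤ) ≤ (i : ℤ) * ((m / 64 / 2 : ℕ) : ℤ) := by positivity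
  have hih' : (i : ℤ) * ((m / 64 / 2 : ℕ) : ℤ) ≤ 89 * ((m / 64 / 2 : ℕ) : ℤ) :=
    mul_le_mul_of_nonneg_right (by exact_mod_cast Nat.le_of_lt_succ hi) (by positivity)
  -- junction 1: the vertical crossing of the target free space meets the horizontal box
  obtain ⟨SH, hSH, PH', TH⟩ := PH.exists_support
  obtain ⟨SV, hSV, PV', TV⟩ := PV.exists_support
  obtain ⟨p₁, hp₁H, hp₁V⟩ := exists_mem_of_cross (L := (m' : ℤ) - (m' / 8 : ℕ) + 1) (R := (m' : ℤ) - 1)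
    (B := -((m' / 2 : ℕ) : ℤ) - (m' / 64 : ℕ)) (T := -((m' / 2 : ℕ) : ℤ) + (m' / 64 : ℕ)) (by omega) (by omega)
    PH' ha₀.le (by omega)
    (fun v hv _ _ => by have h := (hSH hv).1; rw [mem_triStrip] at h; omega)
    PV' hb₀.le (by omega)
    (fun v hv _ _ => by
      have h := (hSV hv).1; rw [mem_triStrip] at h
      have e : ((m' / 8 - 2 : ℕ) : ℤ) = (m' / 8 : ℕ) - 2 := by omega
      omega)
  -- the new free space is crossed through `p₁`
  have hSVF : SV ⊆ sepInnerFence m' z'' ∩ ω := fun v hv => ⟨sepInCorrFence_subset_sepInnerFence (by omega) (hSV hv).1, (hSV hv).2⟩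
  have hFence : OpenVCrossThrough (sepInnerFence m' z'') (z'' 1 - (m' / 64 : ℕ)) (z'' 1 + (m' / 64 : ℕ)) ω p₁ :=
    ⟨b₀, t₀, by rw [hz''1, hb₀], by rw [hz''1, ht₀]; ring, (TV p₁ hp₁V).mono hSVF,
      ((TV p₁ hp₁V).symm.trans (TV t₀ PV'.right_mem)).mono hSVF⟩
  -- junctions 2–4 by relays
  have Q1 : PathIn triGraph (triStrip ((m' : ℤ) - (m' / 8 : ℕ) + 1) (-((m' / 2 : ℕ) : ℤ)) (m - m / 8 - m' + m' / 8 - 3) (m' / 64) ∩ ω)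
      p₁ a₀ := (TH p₁ hp₁H).symm.mono hSH
  have Q2 := PathIn.relay (L := (m : ℤ) - (m / 8 : ℕ) - (m / 16 : ℕ) - 2) (R := (m : ℤ) - (m / 8 : ℕ) - 2)
    (B := -(sepGlueHeight m : ℤ)) (T := -((m' / 2 : ℕ) : ℤ) + (m / 32 : ℕ)) (by omega) (by omega) PH (by omega) (by omega)
    (fun v hv _ _ => by rw [mem_triStrip] at hv; omega) PVh hbh.le (by omega)
    (fun v hv _ _ => by rw [mem_triStrip] at hv; push_cast at hv; omega)
  have Q3 := PathIn.relay (L := (m : ℤ) - (m / 8 : ℕ) - (m / 16 : ℕ) - 2) (R := (m : ℤ) - (m / 8 : ℕ) - 2)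
    (B := -(sepGlueHeight m : ℤ)) (T := -((m' / 2 : ℕ) : ℤ) + (m / 32 : ℕ)) (by omega) (by omega) PG hg₀.le (by omega)
    (fun v hv _ _ => by rw [sepInCombQ_strip_iff] at hv; omega) PVh hbh.le (by omega)
    (fun v hv _ _ => by rw [mem_triStrip] at hv; push_cast at hv; omega)
  have Q4 := PathIn.relay (L := (m : ℤ) - (m / 8 : ℕ)) (R := (m : ℤ) - 1) (B := z 1 - (m / 64 : ℕ)) (T := z 1 + (m / 64 : ℕ))
    (by omega) (by omega) PG (by omega) (by omega)
    (fun v hv _ _ => by rw [sepInCombQ_strip_iff] at hv; omega) (Pa.trans Pb) hb.le ht.ge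
    (fun v hv _ _ => by rw [mem_sepInnerFence] at hv; omega)
  -- assemble inside the new arm region
  have hN1 : m ≤ N := by omega
  have R1 : triStrip ((m' : ℤ) - (m' / 8 : ℕ) + 1) (-((m' / 2 : ℕ) : ℤ)) (m - m / 8 - m' + m' / 8 - 3) (m' / 64) ⊆
      triAnnulusSet m' N ∪ frameIso q '' triOpenBall zo (N / 8) ∪ triOpenBall z'' (m' / 8) := by
    intro v hv
    rcases sepInCorrHBox_subset_sepJoinRegion (N := N) (by omega) hmm' hN1 zo hv with (hv' | hv') | hv'
    · exact Or.inl (Or.inl hv')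
    · -- the outer ball case does not occur for sites of the box, but is harmless
      rw [mem_triOpenBall, triNorm_lt_iff_lin] at hv'
      rw [mem_triStrip, cast_sepInCorr_width (by omega) hmm'] at hv
      rw [mem_sepLanding] at hzo
      simp only [Pi.sub_apply] at hv'
      exfalso; omega
    · exact Or.inr hv'
  have R4 := sepInnerFence_subset_triAnnulusSet (N := N) hmm' hN1 hz
  have RVh : triStrip ((m : ℤ) - (m / 8 : ℕ) - (m / 16 : ℕ) - 2) (-(sepGlueHeight m : ℤ)) (m / 16) (sepGlueHeight m - m' / 2 + m / 32) ⊆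
      triAnnulusSet m' N := fun v hv => by
    rw [mem_triStrip, cast_highway_height (by omega) hmm'] at hv
    push_cast at hv
    exact mem_triAnnulusSet_of_cols_rows hmm' (by omega) hN1 (by omega) (by omega) hv.2.2.1 (by omega)
  have RG : triStrip ((m : ℤ) - (m / 8 : ℕ) - (m / 16 : ℕ) - 2) (-(sepGlueHeight m : ℤ) + i * ((m / 64 / 2 : ℕ) : ℤ)) (m / 8 + m / 16 + 1) (m / 64 / 2) ⊆
      triAnnulusSet m' N := fun v hv => by
    rw [sepInCombQ_strip_iff] at hv
    exact mem_triAnnulusSet_of_cols_rows hmm' (by omega) hN1 (by omega) hv.2.1 (by omega) (by omega)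
  have hann : triAnnulusSet m' N ⊆ triAnnulusSet m' N ∪ frameIso q '' triOpenBall zo (N / 8) ∪ triOpenBall z'' (m' / 8) :=
    fun v hv => Or.inl (Or.inl hv)
  have R5 : triAnnulusSet m N ∪ frameIso q '' triOpenBall zo (N / 8) ∪ triOpenBall z (m / 8) ⊆
      triAnnulusSet m' N ∪ frameIso q '' triOpenBall zo (N / 8) ∪ triOpenBall z'' (m' / 8) := by
    have hN' : 2 * (m : ℤ) ≤ N := by exact_mod_cast hN
    have hmm : 2 * (m' : ℤ) + 1 ≤ m := by exact_mod_cast hmm'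
    rintro v ((hv | hv) | hv)
    · rw [mem_triAnnulusSet] at hv
      exact Or.inl (Or.inl ⟨by omega, hv.2⟩)
    · exact Or.inl (Or.inr hv)
    · rw [mem_triOpenBall, triNorm_lt_iff_lin] at hv
      simp only [Pi.sub_apply] at hv
      refine Or.inl (Or.inl ⟨le_triNorm_iff_lin.2 (Or.inl (by omega)), triNorm_le_iff_lin.2 ?_⟩)
      omega
  set Rnew := triAnnulusSet m' N ∪ frameIso q '' triOpenBall zo (N / 8) ∪ triOpenBall z'' (m' / 8) with hRnew
  have P1 : PathIn triGraph (Rnew ∩ ω) p₁ a₀ := Q1.mono fun v hv => ⟨R1 hv.1, hv.2⟩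
  have P2 : PathIn triGraph (Rnew ∩ ω) a₀ bh := by
    refine Q2.mono ?_
    rintro v ⟨hv | hv, hvω⟩
    exacts [⟨R1 hv, hvω⟩, ⟨hann (RVh hv), hvω⟩]
  have P3 : PathIn triGraph (Rnew ∩ ω) bh g₀ := by
    refine Q3.symm.mono ?_
    rintro v ⟨hv | hv, hvω⟩
    exacts [⟨hann (RG hv), hvω⟩, ⟨hann (RVh hv), hvω⟩]
  have P4 : PathIn triGraph (Rnew ∩ ω) g₀ b := by
    refine Q4.mono ?_
    rintro v ⟨hv | hv, hvω⟩
    exacts [⟨hann (RG hv), hvω⟩, ⟨hann (R4 hv), hvω⟩]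
  have P6 : PathIn triGraph (Rnew ∩ ω) b u := Pa.mono fun v hv => ⟨hann (R4 hv.1), hv.2⟩
  have P7 : PathIn triGraph (Rnew ∩ ω) u (frameIso q uo) := P5.mono fun v hv => ⟨R5 hv.1, hv.2⟩
  exact ⟨z'', zo, p₁, uo, mk_mem_sepLanding m', hzo, hFence, hOut, ((((P1.trans P2).trans P3).trans P4).trans P6).trans P7⟩

/-- The corridor event of the landing index `e`, in its colour and frame. [folklore] -/
def inCorrE (m m' : ℕ) (e : Fin 4) : Set (SiteConfig (Site 2)) :=
  {ω | frameConfig (Slot4.ts e) (colCfg (Slot4.col e) ω) ∈ sepInCorrQ m m'}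

/-- **Inward extension of the four arms**: `sepFourArmG m N q ∩ ⋂ₑ inCorrE m m' e ⊆ sepFourArmG m' N q`. [cite: Nolin2008, §4.3 Prop. 12 (i) (proof) (arXiv 0711.4948: Prop. 11); §4.4 p. 13] -/
theorem sepFourArmG_inter_corr_subset {m m' N q : ℕ} (hm' : 1100 ≤ m') (hmm' : 2 * m' + 1 ≤ m) (hm3 : m ≤ 3 * m') (hN : 2 * m ≤ N) :
    sepFourArmG m N q ∩ (⋂ e, inCorrE m m' e) ⊆ sepFourArmG m' N q := by
  rintro ω ⟨hA, hC⟩ e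
  exact sepArmGen_inter_sepInCorrQ_subset hm' hmm' hm3 hN ⟨hA e, (Set.mem_iInter.1 hC) e⟩

/-! ### Locality and probability of the corridor -/

/-- The sites of the boxes of the corridor. [folklore] -/
def sepInCorrQFinset (m m' : ℕ) : Finset (Site 2) :=
  triStripFinset ((m' : ℤ) - (m' / 8 : ℕ) + 1) (-((m' / 2 : ℕ) : ℤ) - (m' / 64 : ℕ)) (m' / 8 - 2) (2 * (m' / 64)) ∪
    triStripFinset ((m' : ℤ) - (m' / 8 : ℕ) + 1) (-((m' / 2 : ℕ) : ℤ)) (m - m / 8 - m' + m' / 8 - 3) (m' / 64) ∪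
    triStripFinset ((m : ℤ) - (m / 8 : ℕ) - (m / 16 : ℕ) - 2) (-(sepGlueHeight m : ℤ)) (m / 16) (sepGlueHeight m - m' / 2 + m / 32) ∪
    (Finset.range 90).biUnion fun i =>
      triStripFinset ((m : ℤ) - (m / 8 : ℕ) - (m / 16 : ℕ) - 2) (-(sepGlueHeight m : ℤ) + i * ((m / 64 / 2 : ℕ) : ℤ)) (m / 8 + m / 16 + 1) (m / 64 / 2)

/-- Arithmetic helper. [folklore] -/
private theorem fl2 (m : ℕ) : 2 * ((m / 2 : ℕ) : ℤ) ≤ m ∧ (m : ℤ) < 2 * ((m / 2 : ℕ) : ℤ) + 2 := by omega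
/-- Arithmetic helper. [folklore] -/
private theorem fl4 (m : ℕ) : 4 * ((m / 4 : ℕ) : ℤ) ≤ m ∧ (m : ℤ) < 4 * ((m / 4 : ℕ) : ℤ) + 4 := by omega
/-- Arithmetic helper. [folklore] -/
private theorem fl8 (m : ℕ) : 8 * ((m / 8 : ℕ) : ℤ) ≤ m ∧ (m : ℤ) < 8 * ((m / 8 : ℕ) : ℤ) + 8 := by omega
/-- Arithmetic helper. [folklore] -/
private theorem fl16 (m : ℕ) : 16 * ((m / 16 : ℕ) : ℤ) ≤ m ∧ (m : ℤ) < 16 * ((m / 16 : ℕ) : ℤ) + 16 := by omega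
/-- Arithmetic helper. [folklore] -/
private theorem fl32 (m : ℕ) : 32 * ((m / 32 : ℕ) : ℤ) ≤ m ∧ (m : ℤ) < 32 * ((m / 32 : ℕ) : ℤ) + 32 := by omega
/-- Arithmetic helper. [folklore] -/
private theorem fl64 (m : ℕ) : 64 * ((m / 64 : ℕ) : ℤ) ≤ m ∧ (m : ℤ) < 64 * ((m / 64 : ℕ) : ℤ) + 64 := by omega

/-- The boxes of the corridor lie inside `Λ̊_m`, in the open sector of the right side
(`64 ≤ m'`, `2m' + 1 ≤ m ≤ 3m'`, `2200 ≤ m`). [folklore] -/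
theorem sepInCorrQFinset_subset {m m' : ℕ} (hm' : 64 ≤ m') (hmm' : 2 * m' + 1 ≤ m) (hm3 : m ≤ 3 * m') (hm : 2200 ≤ m) {v : Site 2}
    (hv : v ∈ sepInCorrQFinset m m') : triNorm v < m ∧ v 1 < 0 ∧ 0 < v 0 + v 1 := by
  have he : ((m' / 8 - 2 : ℕ) : ℤ) = (m' / 8 : ℕ) - 2 := by omega
  have hw : ((m - m / 8 - m' + m' / 8 - 3 : ℕ) : ℤ) = (m : ℤ) - (m / 8 : ℕ) - m' + (m' / 8 : ℕ) - 3 := cast_sepInCorr_width hm' hmm'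
  have hh : ((sepGlueHeight m - m' / 2 + m / 32 : ℕ) : ℤ) = (sepGlueHeight m : ℤ) - (m' / 2 : ℕ) + (m / 32 : ℕ) := cast_highway_height hm' hmm'
  have hmz : 2 * (m' : ℤ) + 1 ≤ m := by exact_mod_cast hmm'
  have hm3z : (m : ℤ) ≤ 3 * m' := by exact_mod_cast hm3
  have hmz' : (2200 : ℤ) ≤ m := by exact_mod_cast hm
  -- floor facts, proved in isolation
  have hH := sepGlueHeight_cast m
  have h4 := fl4 m; have h8 := fl8 m; have h16 := fl16 m; have h32 := fl32 m; have h64 := fl64 m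
  have h128 := fl2 (m / 64)
  have g2 := fl2 m'; have g8 := fl8 m'; have g64 := fl64 m'
  simp only [sepInCorrQFinset, Finset.mem_union, Finset.mem_biUnion, Finset.mem_range] at hv
  rcases hv with ((hv | hv) | hv) | ⟨i, hi, hv⟩
  · rw [← Finset.mem_coe, coe_triStripFinset, mem_triStrip, he] at hv
    simp only [Nat.cast_mul, Nat.cast_ofNat] at hv
    obtain ⟨hv1, hv2, hv3, hv4⟩ := hv
    refine ⟨triNorm_lt_iff_lin.2 ⟨?_, ?_, ?_, ?_, ?_, ?_⟩, ?_, ?_⟩ <;> linarith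
  · rw [← Finset.mem_coe, coe_triStripFinset, mem_triStrip, hw] at hv
    obtain ⟨hv1, hv2, hv3, hv4⟩ := hv
    refine ⟨triNorm_lt_iff_lin.2 ⟨?_, ?_, ?_, ?_, ?_, ?_⟩, ?_, ?_⟩ <;> linarith
  · rw [← Finset.mem_coe, coe_triStripFinset, mem_triStrip, hh] at hv
    obtain ⟨hv1, hv2, hv3, hv4⟩ := hv
    refine ⟨triNorm_lt_iff_lin.2 ⟨?_, ?_, ?_, ?_, ?_, ?_⟩, ?_, ?_⟩ <;> linarith
  · rw [← Finset.mem_coe, coe_triStripFinset, sepInCombQ_strip_iff] at hv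
    have hih : (0 : ℤ) ≤ (i : ℤ) * ((m / 64 / 2 : ℕ) : ℤ) := by positivity
    have hih' : (i : ℤ) * ((m / 64 / 2 : ℕ) : ℤ) ≤ 89 * ((m / 64 / 2 : ℕ) : ℤ) :=
      mul_le_mul_of_nonneg_right (by exact_mod_cast Nat.le_of_lt_succ hi) (by positivity)
    obtain ⟨hv1, hv2, hv3, hv4⟩ := hv
    refine ⟨triNorm_lt_iff_lin.2 ⟨?_, ?_, ?_, ?_, ?_, ?_⟩, ?_, ?_⟩ <;> linarith

/-- `sepInCorrQ` is determined by the sites of its boxes. [folklore] -/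
theorem determinedBy_sepInCorrQ (m m' : ℕ) : DeterminedBy (sepInCorrQ m m') ↑(sepInCorrQFinset m m') := by
  have c1 : (↑(triStripFinset ((m' : ℤ) - (m' / 8 : ℕ) + 1) (-((m' / 2 : ℕ) : ℤ) - (m' / 64 : ℕ)) (m' / 8 - 2) (2 * (m' / 64))) : Set (Site 2)) ⊆
      ↑(sepInCorrQFinset m m') :=
    Finset.coe_subset.2 (Finset.subset_union_left.trans (Finset.subset_union_left.trans Finset.subset_union_left))
  have c2 : (↑(triStripFinset ((m' : ℤ) - (m' / 8 : ℕ) + 1) (-((m' / 2 : ℕ) : ℤ)) (m - m / 8 - m' + m' / 8 - 3) (m' / 64)) : Set (Site 2)) ⊆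
      ↑(sepInCorrQFinset m m') :=
    Finset.coe_subset.2 (Finset.subset_union_right.trans (Finset.subset_union_left.trans Finset.subset_union_left))
  have c3 : (↑(triStripFinset ((m : ℤ) - (m / 8 : ℕ) - (m / 16 : ℕ) - 2) (-(sepGlueHeight m : ℤ)) (m / 16) (sepGlueHeight m - m' / 2 + m / 32)) : Set (Site 2)) ⊆
      ↑(sepInCorrQFinset m m') :=
    Finset.coe_subset.2 (Finset.subset_union_right.trans Finset.subset_union_left)
  have c4 : (↑((Finset.range 90).biUnion fun i : ℕ =>
      triStripFinset ((m : ℤ) - (m / 8 : ℕ) - (m / 16 : ℕ) - 2) (-(sepGlueHeight m : ℤ) + i * ((m / 64 / 2 : ℕ) : ℤ)) (m / 8 + m / 16 + 1) (m / 64 / 2)) :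
        Set (Site 2)) ⊆ ↑(sepInCorrQFinset m m') :=
    Finset.coe_subset.2 Finset.subset_union_right
  refine ((((determinedBy_triVCross _ _ _ _).mono c1).inter ((determinedBy_triHCross _ _ _ _).mono c2)).inter
    ((determinedBy_triVCross _ _ _ _).mono c3)).inter ?_
  exact (DeterminedBy.biInter_finset (Finset.range 90) (E := fun i => sepInCombQ m i)
    (F := fun i : ℕ => triStripFinset ((m : ℤ) - (m / 8 : ℕ) - (m / 16 : ℕ) - 2) (-(sepGlueHeight m : ℤ) + i * ((m / 64 / 2 : ℕ) : ℤ)) (m / 8 + m / 16 + 1) (m / 64 / 2))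
    fun i _ => determinedBy_triHCross _ _ _ _).mono c4

/-- Framing the corridor in the frame `i`: determined by the image of its sites (both colours). [folklore] -/
theorem determinedBy_frame_sepInCorrQ (i m m' : ℕ) :
    DeterminedBy {ω : SiteConfig (Site 2) | frameConfig i ω ∈ sepInCorrQ m m'} (frameIso i '' ↑(sepInCorrQFinset m m')) ∧
      DeterminedBy {ω : SiteConfig (Site 2) | frameConfig i ωᶜ ∈ sepInCorrQ m m'} (frameIso i '' ↑(sepInCorrQFinset m m')) := by
  have hE := determinedBy_preimage_frameConfig i (determinedBy_sepInCorrQ m m')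
  refine ⟨hE, ?_⟩
  have h2 : {ω : SiteConfig (Site 2) | frameConfig i ωᶜ ∈ sepInCorrQ m m'} =
      {ω : SiteConfig (Site 2) | ωᶜ ∈ {χ : SiteConfig (Site 2) | frameConfig i χ ∈ sepInCorrQ m m'}} := by
    ext ω; simp only [Set.mem_setOf_eq]
  rw [h2]
  exact DeterminedBy.preimage_compl' hE

/-- **RSW and Harris for the bent corridor at `q`**: if `c ≤ P_q(long-way crossing of
`[0, ⌊ρ k⌋] × [0, k]`)` for `1 ≤ k ≤ Ncap` (`ρ ≥ 256`, `c ≥ 0`), then `P_q(sepInCorrQ m m') ≥ c^93`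
for `1100 ≤ m'`, `2m' + 1 ≤ m ≤ 3m'`, `m ≤ Ncap`. [cite: Nolin2008, §4.3 Prop. 12 (proof) (arXiv 0711.4948: Prop. 11)] -/
theorem le_real_sepInCorrQ_at (q : unitInterval) {c : ℝ} {ρ Ncap : ℕ}
    (hrsw : ∀ k : ℕ, 1 ≤ ⌊(ρ : ℝ) * k⌋₊ → k ≤ Ncap → c ≤ triLRCrossingProb q ⌊(ρ : ℝ) * k⌋₊ k)
    (hρ : 256 ≤ ρ) (hc : 0 ≤ c) {m m' : ℕ} (hm' : 1100 ≤ m') (hmm' : 2 * m' + 1 ≤ m) (hm3 : m ≤ 3 * m') (hcap : m ≤ Ncap) :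
    c ^ 93 ≤ (triSitePercolation q).real (sepInCorrQ m m') := by
  classical
  have hfl : ∀ k : ℕ, ⌊(ρ : ℝ) * (k : ℕ)⌋₊ = ρ * k := fun k => by
    have : (ρ : ℝ) * (k : ℕ) = ((ρ * k : ℕ) : ℝ) := by push_cast; ring
    rw [this, Nat.floor_natCast]
  have hcw : ∀ L k : ℕ, 1 ≤ k → k ≤ Ncap → L ≤ 256 * k → c ≤ triLRCrossingProb q L k := fun L k hk hkc hL => by
    have h := hrsw k (by rw [hfl]; nlinarith) hkc
    rw [hfl] at h
    exact h.trans (triLRCrossingProb_anti_width q (by nlinarith) k)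
  set F := sepInCorrQFinset m m' with hF
  set E1 := triVCross ((m' : ℤ) - (m' / 8 : ℕ) + 1) (-((m' / 2 : ℕ) : ℤ) - (m' / 64 : ℕ)) (m' / 8 - 2) (2 * (m' / 64)) with hE1
  set E2 := triHCross ((m' : ℤ) - (m' / 8 : ℕ) + 1) (-((m' / 2 : ℕ) : ℤ)) (m - m / 8 - m' + m' / 8 - 3) (m' / 64) with hE2
  set E3 := triVCross ((m : ℤ) - (m / 8 : ℕ) - (m / 16 : ℕ) - 2) (-(sepGlueHeight m : ℤ)) (m / 16) (sepGlueHeight m - m' / 2 + m / 32) with hE3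
  set G := ⋂ i ∈ Finset.range 90, sepInCombQ m i with hG
  have c1 : (↑(triStripFinset ((m' : ℤ) - (m' / 8 : ℕ) + 1) (-((m' / 2 : ℕ) : ℤ) - (m' / 64 : ℕ)) (m' / 8 - 2) (2 * (m' / 64))) : Set (Site 2)) ⊆ ↑F :=
    Finset.coe_subset.2 (Finset.subset_union_left.trans (Finset.subset_union_left.trans Finset.subset_union_left))
  have c2 : (↑(triStripFinset ((m' : ℤ) - (m' / 8 : ℕ) + 1) (-((m' / 2 : ℕ) : ℤ)) (m - m / 8 - m' + m' / 8 - 3) (m' / 64)) : Set (Site 2)) ⊆ ↑F :=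
    Finset.coe_subset.2 (Finset.subset_union_right.trans (Finset.subset_union_left.trans Finset.subset_union_left))
  have c3 : (↑(triStripFinset ((m : ℤ) - (m / 8 : ℕ) - (m / 16 : ℕ) - 2) (-(sepGlueHeight m : ℤ)) (m / 16) (sepGlueHeight m - m' / 2 + m / 32)) : Set (Site 2)) ⊆ ↑F :=
    Finset.coe_subset.2 (Finset.subset_union_right.trans Finset.subset_union_left)
  have c4 : (↑((Finset.range 90).biUnion fun i : ℕ =>
      triStripFinset ((m : ℤ) - (m / 8 : ℕ) - (m / 16 : ℕ) - 2) (-(sepGlueHeight m : ℤ) + i * ((m / 64 / 2 : ℕ) : ℤ)) (m / 8 + m / 16 + 1) (m / 64 / 2)) :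
        Set (Site 2)) ⊆ ↑F :=
    Finset.coe_subset.2 Finset.subset_union_right
  have d1 : DeterminedBy E1 ↑F := (determinedBy_triVCross _ _ _ _).mono c1
  have d2 : DeterminedBy E2 ↑F := (determinedBy_triHCross _ _ _ _).mono c2
  have d3 : DeterminedBy E3 ↑F := (determinedBy_triVCross _ _ _ _).mono c3
  have dG : DeterminedBy G ↑F := (DeterminedBy.biInter_finset (Finset.range 90) (E := fun i => sepInCombQ m i)
    (F := fun i : ℕ => triStripFinset ((m : ℤ) - (m / 8 : ℕ) - (m / 16 : ℕ) - 2) (-(sepGlueHeight m : ℤ) + i * ((m / 64 / 2 : ℕ) : ℤ)) (m / 8 + m / 16 + 1) (m / 64 / 2))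
    fun i _ => determinedBy_triHCross _ _ _ _).mono c4
  have u1 : IsUpperSet E1 := isUpperSet_triVCross _ _ _ _
  have u2 : IsUpperSet E2 := isUpperSet_triHCross _ _ _ _
  have u3 : IsUpperSet E3 := isUpperSet_triVCross _ _ _ _
  have uG : IsUpperSet G := isUpperSet_iInter₂ fun i _ => isUpperSet_triHCross _ _ _ _
  have hGH : sepGlueHeight m = m - m / 4 + m / 64 := rfl
  have e1 : c ≤ (triSitePercolation q).real E1 := by
    rw [hE1, triSitePercolation_real_triVCross]; exact hcw _ _ (by omega) (by omega) (by omega)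
  have e2 : c ≤ (triSitePercolation q).real E2 := by
    rw [hE2, triSitePercolation_real_triHCross]; exact hcw _ _ (by omega) (by omega) (by omega)
  have e3 : c ≤ (triSitePercolation q).real E3 := by
    rw [hE3, triSitePercolation_real_triVCross]; exact hcw _ _ (by omega) (by omega) (by rw [hGH]; omega)
  have eG : c ^ 90 ≤ (triSitePercolation q).real G := by
    have hprod := sitePercolation_real_biInter_ge_prod q (Finset.range 90) (E := fun i => sepInCombQ m i)
      (F := fun i => triStripFinset ((m : ℤ) - (m / 8 : ℕ) - (m / 16 : ℕ) - 2) (-(sepGlueHeight m : ℤ) + i * ((m / 64 / 2 : ℕ) : ℤ)) (m / 8 + m / 16 + 1) (m / 64 / 2))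
      (fun i _ => determinedBy_triHCross _ _ _ _) (fun i _ => isUpperSet_triHCross _ _ _ _)
    have heach : ∀ i ∈ Finset.range 90, c ≤ (sitePercolation (Site 2) q).real (sepInCombQ m i) := fun i _ => by
      have := triSitePercolation_real_triHCross q ((m : ℤ) - (m / 8 : ℕ) - (m / 16 : ℕ) - 2)
        (-(sepGlueHeight m : ℤ) + i * ((m / 64 / 2 : ℕ) : ℤ)) (m / 8 + m / 16 + 1) (m / 64 / 2)
      unfold triSitePercolation at this
      rw [sepInCombQ, this]
      exact hcw _ _ (by omega) (by omega) (by omega)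
    have hle : c ^ 90 ≤ ∏ i ∈ Finset.range 90, (sitePercolation (Site 2) q).real (sepInCombQ m i) := by
      calc c ^ 90 = ∏ _i ∈ Finset.range 90, c := by rw [Finset.prod_const, Finset.card_range]
        _ ≤ _ := Finset.prod_le_prod (fun _ _ => hc) heach
    unfold triSitePercolation
    exact hle.trans hprod
  have h12 := sitePercolation_harris q d1 d2 u1 u2
  have h123 := sitePercolation_harris q (d1.inter d2) d3 (u1.inter u2) u3
  have h1234 := sitePercolation_harris q ((d1.inter d2).inter d3) dG ((u1.inter u2).inter u3) uG
  have hdef : sepInCorrQ m m' = E1 ∩ E2 ∩ E3 ∩ G := rfl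
  unfold triSitePercolation at e1 e2 e3 eG ⊢
  rw [hdef]
  set μ := sitePercolation (Site 2) q with hμ
  have h0 : ∀ s, 0 ≤ μ.real s := fun s => measureReal_nonneg
  calc c ^ 93 = c * c * c * c ^ 90 := by ring
    _ ≤ μ.real E1 * μ.real E2 * μ.real E3 * μ.real G := by
        have t2 := mul_le_mul e1 e2 hc (h0 _)
        have t3 := mul_le_mul t2 e3 hc (mul_nonneg (h0 _) (h0 _))
        exact mul_le_mul t3 eG (pow_nonneg hc _) (mul_nonneg (mul_nonneg (h0 _) (h0 _)) (h0 _))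
    _ ≤ μ.real (E1 ∩ E2) * μ.real E3 * μ.real G :=
        mul_le_mul_of_nonneg_right (mul_le_mul_of_nonneg_right h12 (h0 _)) (h0 _)
    _ ≤ μ.real (E1 ∩ E2 ∩ E3) * μ.real G := mul_le_mul_of_nonneg_right h123 (h0 _)
    _ ≤ μ.real (E1 ∩ E2 ∩ E3 ∩ G) := h1234

/-! ### The extension inequality -/

/-- The four-arm event as the intersection of its increasing and decreasing halves. [folklore] -/
theorem sepFourArmG_eq_inter (n N q : ℕ) :
    sepFourArmG n N q = ({ω | frameConfig 0 ω ∈ sepArmGen n N q} ∩ {ω | frameConfig 3 ω ∈ sepArmGen n N q}) ∩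
      ({ω | frameConfig 2 ωᶜ ∈ sepArmGen n N q} ∩ {ω | frameConfig 5 ωᶜ ∈ sepArmGen n N q}) := by
  ext ω
  obtain ⟨c0, c1, c2, c3⟩ := Slot4.col_vals
  have t0 : Slot4.ts 0 = 0 := rfl
  have t1 : Slot4.ts 1 = 2 := rfl
  have t2 : Slot4.ts 2 = 3 := rfl
  have t3 : Slot4.ts 3 = 5 := rfl
  simp only [sepFourArmG, Set.mem_setOf_eq, Set.mem_inter_iff]
  constructor
  · intro h
    have h0 := h 0; have h1 := h 1; have h2 := h 2; have h3 := h 3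
    rw [t0, c0, colCfg_true] at h0
    rw [t1, c1, colCfg_false] at h1
    rw [t2, c2, colCfg_true] at h2
    rw [t3, c3, colCfg_false] at h3
    exact ⟨⟨h0, h2⟩, h1, h3⟩
  · rintro ⟨⟨h0, h2⟩, h1, h3⟩ e
    fin_cases e
    · show frameConfig (Slot4.ts 0) (colCfg (Slot4.col 0) ω) ∈ _; rw [t0, c0, colCfg_true]; exact h0
    · show frameConfig (Slot4.ts 1) (colCfg (Slot4.col 1) ω) ∈ _; rw [t1, c1, colCfg_false]; exact h1
    · show frameConfig (Slot4.ts 2) (colCfg (Slot4.col 2) ω) ∈ _; rw [t2, c2, colCfg_true]; exact h2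
    · show frameConfig (Slot4.ts 3) (colCfg (Slot4.col 3) ω) ∈ _; rw [t3, c3, colCfg_false]; exact h3

/-- **Inward extension of the four landed arms at constant cost, at `p`** (Nolin 2008, Prop. 12 (i)
on the internal boundary via Lemma 13; §4.4 pp. 12–13, the constant `C₀`): with the RSW input `hrsw`
at `p` and at `1 - p` (aspect ratio `ρ ≥ 256`, short sides `≤ Ncap`), for `1100 ≤ m'`,
`2m' + 1 ≤ m ≤ 3m'`, `2m ≤ N`, `m ≤ Ncap`, `q < 6`:
`P_p(sepFourArmG m N q) · (c^93)⁴ ≤ P_p(sepFourArmG m' N q)`. [cite: Nolin2008, §4.3 Prop. 12 (i) and Lemma 13 (arXiv 0711.4948: Prop. 11, Lemma 12); §4.4 pp. 12–13] -/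
theorem real_sepFourArmG_mul_le_inward_at (p : unitInterval) {c : ℝ} {ρ Ncap : ℕ}
    (hrsw : ∀ q' : unitInterval, (q' = p ∨ q' = unitInterval.symm p) →
      ∀ k : ℕ, 1 ≤ ⌊(ρ : ℝ) * k⌋₊ → k ≤ Ncap → c ≤ triLRCrossingProb q' ⌊(ρ : ℝ) * k⌋₊ k)
    (hρ : 256 ≤ ρ) (hc : 0 ≤ c) {m m' N q : ℕ} (hq : q < 6) (hm' : 1100 ≤ m') (hmm' : 2 * m' + 1 ≤ m) (hm3 : m ≤ 3 * m')
    (hN : 2 * m ≤ N) (hcap : m ≤ Ncap) :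
    (triSitePercolation p).real (sepFourArmG m N q) * (c ^ 93) ^ 4 ≤ (triSitePercolation p).real (sepFourArmG m' N q) := by
  classical
  set C := sepInCorrQ m m' with hC
  set E := sepArmGen m N q with hE
  -- the three pairwise disjoint regions of Nolin's Lemma 13
  set S : Finset (Site 2) := (triBall (N + N / 8)).filter (fun v => (m : ℤ) ≤ triNorm v) with hS
  set P : Finset (Site 2) := (triBall m).filter
    (fun v => triNorm v < (m : ℤ) ∧ ((v 1 ≤ 0 ∧ 0 < v 0 + v 1) ∨ (0 ≤ v 1 ∧ v 0 + v 1 < 0))) with hP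
  set M : Finset (Site 2) := (triBall m).filter
    (fun v => triNorm v < (m : ℤ) ∧ ((v 0 ≤ 0 ∧ 0 < v 0 + v 1) ∨ (0 ≤ v 0 ∧ v 0 + v 1 < 0))) with hM
  have hSP : Disjoint S P := by
    rw [Finset.disjoint_left]; intro v hvS hvP
    simp only [hS, hP, Finset.mem_filter, mem_triBall_iff] at hvS hvP
    omega
  have hSM : Disjoint S M := by
    rw [Finset.disjoint_left]; intro v hvS hvM
    simp only [hS, hM, Finset.mem_filter, mem_triBall_iff] at hvS hvM
    omega
  have hPM : Disjoint P M := by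
    rw [Finset.disjoint_left]; intro v hvP hvM
    simp only [hP, hM, Finset.mem_filter] at hvP hvM
    omega
  have hm64 : 64 ≤ m := by omega
  -- supports of the arms
  have coneSup : ∀ (i : ℕ) (hi : i < 6), (i = 0 ∨ i = 3 → frameIso i '' armConeSet m N ⊆ ↑S ∪ ↑P) ∧
      (i = 2 ∨ i = 5 → frameIso i '' armConeSet m N ⊆ ↑S ∪ ↑M) := by
    intro i hi
    constructor
    · rintro hi0 v ⟨u, hu, rfl⟩
      rw [mem_armConeSet] at hu
      obtain ⟨f00, f01, -, -, -, -, f30, f31, -⟩ := frameIso_apply_formula u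
      simp only [hS, hP, Set.mem_union, Finset.mem_coe, Finset.mem_filter, mem_triBall_iff, triNorm_frameIso i hi]
      push_cast at hu ⊢
      by_cases h : (m : ℤ) ≤ triNorm u
      · left; exact ⟨hu.2.1, h⟩
      · right
        refine ⟨by omega, by omega, ?_⟩
        have hc := hu.2.2 (by omega)
        rcases hi0 with rfl | rfl
        · left; rw [f00, f01]; omega
        · right; rw [f30, f31]; omega
    · rintro hi2 v ⟨u, hu, rfl⟩
      rw [mem_armConeSet] at hu
      obtain ⟨-, -, -, -, f20, f21, -, -, -, -, f50, f51⟩ := frameIso_apply_formula u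
      simp only [hS, hM, Set.mem_union, Finset.mem_coe, Finset.mem_filter, mem_triBall_iff, triNorm_frameIso i hi]
      push_cast at hu ⊢
      by_cases h : (m : ℤ) ≤ triNorm u
      · left; exact ⟨hu.2.1, h⟩
      · right
        refine ⟨by omega, by omega, ?_⟩
        have hc := hu.2.2 (by omega)
        rcases hi2 with rfl | rfl
        · left; rw [f20, f21]; omega
        · right; rw [f50, f51]; omega
  -- supports of the corridors
  have corrSup : ∀ (i : ℕ) (hi : i < 6), (i = 0 ∨ i = 3 → frameIso i '' ↑(sepInCorrQFinset m m') ⊆ ↑P) ∧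
      (i = 2 ∨ i = 5 → frameIso i '' ↑(sepInCorrQFinset m m') ⊆ ↑M) := by
    intro i hi
    constructor
    · rintro hi0 v ⟨u, hu, rfl⟩
      have h := sepInCorrQFinset_subset (by omega) hmm' hm3 (by omega) (Finset.mem_coe.1 hu)
      obtain ⟨f00, f01, -, -, -, -, f30, f31, -⟩ := frameIso_apply_formula u
      simp only [hP, Finset.mem_coe, Finset.mem_filter, mem_triBall_iff, triNorm_frameIso i hi]
      refine ⟨h.1.le, h.1, ?_⟩
      rcases hi0 with rfl | rfl
      · left; rw [f00, f01]; omega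
      · right; rw [f30, f31]; omega
    · rintro hi2 v ⟨u, hu, rfl⟩
      have h := sepInCorrQFinset_subset (by omega) hmm' hm3 (by omega) (Finset.mem_coe.1 hu)
      obtain ⟨-, -, -, -, f20, f21, -, -, -, -, f50, f51⟩ := frameIso_apply_formula u
      simp only [hM, Finset.mem_coe, Finset.mem_filter, mem_triBall_iff, triNorm_frameIso i hi]
      refine ⟨h.1.le, h.1, ?_⟩
      rcases hi2 with rfl | rfl
      · left; rw [f20, f21]; omega
      · right; rw [f50, f51]; omega
  -- the events
  set Ap : Set (SiteConfig (Site 2)) := {ω | frameConfig 0 ω ∈ E} ∩ {ω | frameConfig 3 ω ∈ E} with hAp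
  set Am : Set (SiteConfig (Site 2)) := {ω | frameConfig 2 ωᶜ ∈ E} ∩ {ω | frameConfig 5 ωᶜ ∈ E} with hAm
  set Bp : Set (SiteConfig (Site 2)) := {ω | frameConfig 0 ω ∈ C} ∩ {ω | frameConfig 3 ω ∈ C} with hBp
  set Bm : Set (SiteConfig (Site 2)) := {ω | frameConfig 2 ωᶜ ∈ C} ∩ {ω | frameConfig 5 ωᶜ ∈ C} with hBm
  have huE := isUpperSet_sepArmGen m N q
  have huC := isUpperSet_sepInCorrQ m m'
  have upre : ∀ {F : Set (SiteConfig (Site 2))}, IsUpperSet F → ∀ i, IsUpperSet {ω : SiteConfig (Site 2) | frameConfig i ω ∈ F} :=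
    fun hF i ω ω' h hω => hF (frameConfig_mono i h) hω
  have lpre : ∀ {F : Set (SiteConfig (Site 2))}, IsUpperSet F → ∀ i, IsLowerSet {ω : SiteConfig (Site 2) | frameConfig i ωᶜ ∈ F} :=
    fun hF i ω ω' h hω => hF (frameConfig_mono i (Set.compl_subset_compl.2 h)) hω
  have hAp_up : IsUpperSet Ap := (upre huE 0).inter (upre huE 3)
  have hAm_lo : IsLowerSet Am := (lpre huE 2).inter (lpre huE 5)
  have hBp_up : IsUpperSet Bp := (upre huC 0).inter (upre huC 3)
  have hBm_lo : IsLowerSet Bm := (lpre huC 2).inter (lpre huC 5)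
  -- locality
  have dE := determinedBy_sepArmGen_cone (m := m) (N := N) hq hm64 hN
  have dEf := fun i => determinedBy_preimage_frameConfig i dE
  have dEfc : ∀ i, DeterminedBy {ω : SiteConfig (Site 2) | frameConfig i ωᶜ ∈ E} (frameIso i '' armConeSet m N) := fun i => by
    have h2 : {ω : SiteConfig (Site 2) | frameConfig i ωᶜ ∈ E} =
        {ω : SiteConfig (Site 2) | ωᶜ ∈ {χ : SiteConfig (Site 2) | frameConfig i χ ∈ E}} := by
      ext ω; simp only [Set.mem_setOf_eq]
    rw [h2]; exact DeterminedBy.preimage_compl' (dEf i)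
  have dAp : DeterminedBy Ap (↑S ∪ ↑P) :=
    ((dEf 0).mono ((coneSup 0 (by norm_num)).1 (Or.inl rfl))).inter ((dEf 3).mono ((coneSup 3 (by norm_num)).1 (Or.inr rfl)))
  have dAm : DeterminedBy Am (↑S ∪ ↑M) :=
    ((dEfc 2).mono ((coneSup 2 (by norm_num)).2 (Or.inl rfl))).inter ((dEfc 5).mono ((coneSup 5 (by norm_num)).2 (Or.inr rfl)))
  have dC := determinedBy_sepInCorrQ m m'
  have dCf := fun i => determinedBy_frame_sepInCorrQ i m m'
  have dBp : DeterminedBy Bp ↑P :=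
    ((dCf 0).1.mono ((corrSup 0 (by norm_num)).1 (Or.inl rfl))).inter ((dCf 3).1.mono ((corrSup 3 (by norm_num)).1 (Or.inr rfl)))
  have dBm : DeterminedBy Bm ↑M :=
    ((dCf 2).2.mono ((corrSup 2 (by norm_num)).2 (Or.inl rfl))).inter ((dCf 5).2.mono ((corrSup 5 (by norm_num)).2 (Or.inr rfl)))
  have fkg := triSitePercolation_locallyMonotone_fkg p hSP hSM hPM hAp_up hAm_lo hBp_up hBm_lo dAp dAm dBp dBm
  -- the corridor probabilities
  have hcorr : ∀ q' : unitInterval, (q' = p ∨ q' = unitInterval.symm p) → c ^ 93 ≤ (triSitePercolation q').real C :=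
    fun q' hq' => le_real_sepInCorrQ_at q' (hrsw q' hq') hρ hc hm' hmm' hm3 hcap
  set F := sepInCorrQFinset m m' with hF
  have hBp_ge : (c ^ 93) ^ 2 ≤ (triSitePercolation p).real Bp := by
    have h0 : (triSitePercolation p).real {ω : SiteConfig (Site 2) | frameConfig 0 ω ∈ C} = (triSitePercolation p).real C :=
      real_preimage_frameConfig p 0 C
    have h3 : (triSitePercolation p).real {ω : SiteConfig (Site 2) | frameConfig 3 ω ∈ C} = (triSitePercolation p).real C :=
      real_preimage_frameConfig p 3 C
    have d0' : DeterminedBy {ω : SiteConfig (Site 2) | frameConfig 0 ω ∈ C} ↑(F.image (frameIso 0)) := by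
      rw [Finset.coe_image]; exact (dCf 0).1
    have d3' : DeterminedBy {ω : SiteConfig (Site 2) | frameConfig 3 ω ∈ C} ↑(F.image (frameIso 3)) := by
      rw [Finset.coe_image]; exact (dCf 3).1
    have har := sitePercolation_harris' p d0' d3' (upre huC 0) (upre huC 3)
    unfold triSitePercolation at h0 h3 hcorr ⊢
    rw [h0, h3] at har
    have h1 := hcorr p (Or.inl rfl)
    calc (c ^ 93) ^ 2 = c ^ 93 * c ^ 93 := sq _
      _ ≤ (sitePercolation (Site 2) p).real C * (sitePercolation (Site 2) p).real C :=
          mul_le_mul h1 h1 (pow_nonneg hc _) measureReal_nonneg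
      _ ≤ _ := har
  have hBm_ge : (c ^ 93) ^ 2 ≤ (triSitePercolation p).real Bm := by
    set q' := unitInterval.symm p with hq'
    have heq : Bm = compl ⁻¹' ({χ : SiteConfig (Site 2) | frameConfig 2 χ ∈ C} ∩ {χ | frameConfig 5 χ ∈ C}) := by
      ext ω; simp only [hBm, Set.mem_inter_iff, Set.mem_setOf_eq, Set.mem_preimage]
    have hcmp := sitePercolation_real_preimage_compl p ({χ : SiteConfig (Site 2) | frameConfig 2 χ ∈ C} ∩ {χ | frameConfig 5 χ ∈ C})
    have h2 : (triSitePercolation q').real {ω : SiteConfig (Site 2) | frameConfig 2 ω ∈ C} = (triSitePercolation q').real C :=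
      real_preimage_frameConfig q' 2 C
    have h5 : (triSitePercolation q').real {ω : SiteConfig (Site 2) | frameConfig 5 ω ∈ C} = (triSitePercolation q').real C :=
      real_preimage_frameConfig q' 5 C
    have d2' : DeterminedBy {ω : SiteConfig (Site 2) | frameConfig 2 ω ∈ C} ↑(F.image (frameIso 2)) := by
      rw [Finset.coe_image]; exact (dCf 2).1
    have d5' : DeterminedBy {ω : SiteConfig (Site 2) | frameConfig 5 ω ∈ C} ↑(F.image (frameIso 5)) := by
      rw [Finset.coe_image]; exact (dCf 5).1
    have har := sitePercolation_harris' q' d2' d5' (upre huC 2) (upre huC 5)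
    unfold triSitePercolation at h2 h5 hcorr hcmp ⊢
    rw [h2, h5] at har
    rw [heq, hcmp]
    have h1 := hcorr q' (Or.inr rfl)
    calc (c ^ 93) ^ 2 = c ^ 93 * c ^ 93 := sq _
      _ ≤ (sitePercolation (Site 2) q').real C * (sitePercolation (Site 2) q').real C :=
          mul_le_mul h1 h1 (pow_nonneg hc _) measureReal_nonneg
      _ ≤ _ := har
  -- assemble
  have hAA : sepFourArmG m N q = Ap ∩ Am := sepFourArmG_eq_inter m N q
  have hcorrE : Bp ∩ Bm ⊆ ⋂ e, inCorrE m m' e := by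
    rintro ω ⟨⟨b0, b3⟩, b2, b5⟩
    obtain ⟨c0, c1, c2, c3⟩ := Slot4.col_vals
    refine Set.mem_iInter.2 fun e => ?_
    fin_cases e
    · show frameConfig 0 (colCfg (Slot4.col 0) ω) ∈ C; rw [c0, colCfg_true]; exact b0
    · show frameConfig 2 (colCfg (Slot4.col 1) ω) ∈ C; rw [c1, colCfg_false]; exact b2
    · show frameConfig 3 (colCfg (Slot4.col 2) ω) ∈ C; rw [c2, colCfg_true]; exact b3
    · show frameConfig 5 (colCfg (Slot4.col 3) ω) ∈ C; rw [c3, colCfg_false]; exact b5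
  have hsub := sepFourArmG_inter_corr_subset (N := N) (q := q) hm' hmm' hm3 hN
  have h0 : 0 ≤ (triSitePercolation p).real (sepFourArmG m N q) := measureReal_nonneg
  calc (triSitePercolation p).real (sepFourArmG m N q) * (c ^ 93) ^ 4
      = (triSitePercolation p).real (sepFourArmG m N q) * ((c ^ 93) ^ 2 * (c ^ 93) ^ 2) := by ring
    _ ≤ (triSitePercolation p).real (Ap ∩ Am) * ((triSitePercolation p).real Bp * (triSitePercolation p).real Bm) := by
        rw [hAA]
        exact mul_le_mul_of_nonneg_left (mul_le_mul hBp_ge hBm_ge (by positivity) measureReal_nonneg) (by rw [← hAA]; exact h0)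
    _ ≤ (triSitePercolation p).real (Ap ∩ Am ∩ (Bp ∩ Bm)) := fkg
    _ ≤ (triSitePercolation p).real (sepFourArmG m' N q) := by
        refine measureReal_mono ?_ (measure_ne_top _ _)
        rw [← hAA]
        rintro ω ⟨hω, hB⟩
        exact hsub ⟨hω, hcorrE hB⟩

end Literature.Probability.Percolation
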